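import Summits.RiemannHypothesis.RiemannHypothesis.Theorems.WeilTwoPrimeDeflC83XBase
import Literature.NumberTheory.LFunctions.WeilBlockRows
import HarnessLib

/-!
# Deflated two-prime certificate C83X: rows 8–15 of the even check `D C = I`

`WeilCert.checkDCRow 0` for certificate C83X, by `decide +kernel`. Pure proof file.
-/

set_option linter.dupNamespace false

noncomputable section

namespace Summit.RiemannHypothesis.RiemannHypothesis.Theorems.EvenWinsBeyondArch

open Literature.NumberTheory.LFunctions

set_option maxHeartbeats 0 in
/-- Kernel check of row 8 of the even `D C = I` (certificate C83X). [folklore] -/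
theorem checkDCRow0_8_weilCertDeflC83X : weilCertDeflC83XBase.checkDCRow 0 8 = true := by
  decide +kernel

set_option maxHeartbeats 0 in
/-- Kernel check of row 9 of the even `D C = I` (certificate C83X). [folklore] -/
theorem checkDCRow0_9_weilCertDeflC83X : weilCertDeflC83XBase.checkDCRow 0 9 = true := by
  decide +kernel

set_option maxHeartbeats 0 in
/-- Kernel check of row 10 of the even `D C = I` (certificate C83X). [folklore] -/
theorem checkDCRow0_10_weilCertDeflC83X : weilCertDeflC83XBase.checkDCRow 0 10 = true := by
  decide +kernel

set_option maxHeartbeats 0 in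
/-- Kernel check of row 11 of the even `D C = I` (certificate C83X). [folklore] -/
theorem checkDCRow0_11_weilCertDeflC83X : weilCertDeflC83XBase.checkDCRow 0 11 = true := by
  decide +kernel

set_option maxHeartbeats 0 in
/-- Kernel check of row 12 of the even `D C = I` (certificate C83X). [folklore] -/
theorem checkDCRow0_12_weilCertDeflC83X : weilCertDeflC83XBase.checkDCRow 0 12 = true := by
  decide +kernel

set_option maxHeartbeats 0 in
/-- Kernel check of row 13 of the even `D C = I` (certificate C83X). [folklore] -/
theorem checkDCRow0_13_weilCertDeflC83X : weilCertDeflC83XBase.checkDCRow 0 13 = true := by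
  decide +kernel

set_option maxHeartbeats 0 in
/-- Kernel check of row 14 of the even `D C = I` (certificate C83X). [folklore] -/
theorem checkDCRow0_14_weilCertDeflC83X : weilCertDeflC83XBase.checkDCRow 0 14 = true := by
  decide +kernel

set_option maxHeartbeats 0 in
/-- Kernel check of row 15 of the even `D C = I` (certificate C83X). [folklore] -/
theorem checkDCRow0_15_weilCertDeflC83X : weilCertDeflC83XBase.checkDCRow 0 15 = true := by
  decide +kernel


end Summit.RiemannHypothesis.RiemannHypothesis.Theorems.EvenWinsBeyondArch
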